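import Mathlib
import Summits.ValiantsHypothesis.ValiantsHypothesis.Theorems.BarrierLeverDefinableEquationsRazIntegrality

/-!
# Crux `BarrierLever.DefinableEquations` (stmt-8745) / `SingleSizeEquations` (stmt-8749) — the
# GRADING of Raz's matrix: `Γ_e` is homogeneous of label-degree `2r - 1` and lives on the degree-`r`
# monomials, so the `ℕ`-system of the combinatorial form is block-diagonal (val-np-p5 g7)

First structural lemmas on the class side of `definableEquations_iff_combinatorial` (Raz 2010,
Prop. 3.2, with the homogeneity that the tree's `RazUniversalCircuits` "does not record"):

* `RazHomogeneity.isHomogeneous_base` — the node `b` of level `d` of the universal circuit-graph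
  computes a form of degree `d` in the leaves `z`; hence `uCoeff_eq_zero_of_degree_ne`:
  `Γ_e = 0` unless `|e| = r`.
* `RazHomogeneity.labHom_base` / `isHomogeneous_uCoeff` — every coordinate `Γ_e` is a HOMOGENEOUS
  polynomial of degree `2r - 1` in the labels (`r ≥ 1`): product slots of level `d` carry
  label-degree `2d - 2`, sum gates add `1`.
* `RazHomogeneity.isHomogeneous_prod_uCoeff` / `coeff_prod_uCoeff_eq_zero` — the entry
  `N_b(m, κ) = coeff_κ ∏_e Γ_e^{m_e}` of Raz's matrix vanishes unless `|κ| = (2n - 1) · |m|`: the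
  nonnegative integer system of `definableEquations_iff_combinatorial` is BLOCK-DIAGONAL by the
  degree `|m|` (a solution may be taken homogeneous — the torus normal form of `…Isobaric.lean`,
  now visible on the matrix).

Route-independent; no definitions (label-homogeneity is spelled out as
`∀ e, (coeff e P).IsHomogeneous D`), no named facts.  Refs: R. Raz, Theory of Computing 6 (2010),
Props. 2.8, 3.2.
-/

set_option linter.dupNamespace false

noncomputable section

namespace Summit.ValiantsHypothesis.ValiantsHypothesis.Theorems.BarrierLeverDefinableEquations

open MvPolynomial Literature.Computability.AlgebraicComplexity
open Literature.Barriers.ValiantsHypothesis RazUniversal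
open scoped BigOperators

namespace RazHomogeneity

variable {R : Type*} [CommSemiring R] {σ : Type*} {r W : ℕ}

/-! ### Homogeneity in the leaves `z` -/

/-- The node `b` of level `d` computes a form of degree `d` in the leaves.
[cite: Raz2010, Prop. 2.8 (p. 154)] -/
theorem isHomogeneous_base [Fintype σ] : ∀ (k : ℕ) (d : Fin (r + 1)), (d : ℕ) = k →
    ∀ b : BIdx σ r W,
    (base (R := R) d b).IsHomogeneous k := by
  intro k
  induction k using Nat.strong_induction_on with
  | _ k ih =>
    rintro d rfl b
    rcases b with t | ⟨j, c⟩
    · rw [base]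
      split_ifs with h1
      · rw [h1]; exact isHomogeneous_X _ t
      · exact isHomogeneous_zero _ _ _
    · rw [base]
      split_ifs with h
      · have hsplit : (d : ℕ) = (j : ℕ) + ((d : ℕ) - j) := by omega
        have h1 : (∑ b : BIdx σ r W,
            C (X (Sum.inl (d, j, c, false, b))) * base (R := R) (Fin.castSucc j) b).IsHomogeneous
            (j : ℕ) :=
          IsHomogeneous.sum _ _ _ fun b _ =>
            IsHomogeneous.C_mul (ih (j : ℕ) h.2 (Fin.castSucc j) rfl b) _
        have h2 : (∑ b : BIdx σ r W,
            C (X (Sum.inl (d, j, c, true, b))) *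
              base (R := R) ⟨(d : ℕ) - j, by have := d.isLt; omega⟩ b).IsHomogeneous
            ((d : ℕ) - j) :=
          IsHomogeneous.sum _ _ _ fun b _ =>
            IsHomogeneous.C_mul (ih ((d : ℕ) - j) (by omega)
              ⟨(d : ℕ) - j, by have := d.isLt; omega⟩ rfl b) _
        have hmul := h1.mul h2
        rw [← hsplit] at hmul
        exact hmul
      · exact isHomogeneous_zero _ _ _

/-- The generic output is a form of degree `r` in the leaves. [cite: Raz2010, Prop. 2.8 (p. 154)] -/
theorem isHomogeneous_out [Fintype σ] : (out R σ r W).IsHomogeneous r :=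
  IsHomogeneous.sum _ _ _ fun b _ =>
    IsHomogeneous.C_mul (isHomogeneous_base r (Fin.last r) rfl b) _

/-- **`Γ_e = 0` unless `|e| = r`.** [cite: Raz2010, §3.2 (p. 157)] -/
theorem uCoeff_eq_zero_of_degree_ne [Fintype σ] {e : σ →₀ ℕ} (he : e.degree ≠ r) :
    uCoeff R σ r W e = 0 :=
  isHomogeneous_out.coeff_eq_zero he

/-! ### Homogeneity in the labels `Y` (coefficientwise) -/

section LabHom

variable {τ : Type*}

/-- Coefficientwise label-homogeneity of a product. [folklore] -/
theorem labHom_mul {P Q : MvPolynomial σ (MvPolynomial τ R)} {D₁ D₂ : ℕ}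
    (hP : ∀ e, (coeff e P).IsHomogeneous D₁) (hQ : ∀ e, (coeff e Q).IsHomogeneous D₂) :
    ∀ e, (coeff e (P * Q)).IsHomogeneous (D₁ + D₂) := by
  classical
  intro e
  rw [coeff_mul]
  exact IsHomogeneous.sum _ _ _ fun x _ => (hP x.1).mul (hQ x.2)

/-- Coefficientwise label-homogeneity of a sum. [folklore] -/
theorem labHom_sum {ι : Type*} (s : Finset ι) {P : ι → MvPolynomial σ (MvPolynomial τ R)} {D : ℕ}
    (h : ∀ i ∈ s, ∀ e, (coeff e (P i)).IsHomogeneous D) :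
    ∀ e, (coeff e (∑ i ∈ s, P i)).IsHomogeneous D := by
  classical
  intro e
  rw [coeff_sum]
  exact IsHomogeneous.sum _ _ _ fun i hi => h i hi e

/-- Multiplying by a label `C (X y)` raises the label-degree by one. [folklore] -/
theorem labHom_CX_mul {P : MvPolynomial σ (MvPolynomial τ R)} {D : ℕ}
    (hP : ∀ e, (coeff e P).IsHomogeneous D) (y : τ) :
    ∀ e, (coeff e (C (X y) * P)).IsHomogeneous (1 + D) := fun e => by
  rw [coeff_C_mul]
  exact (isHomogeneous_X R y).mul (hP e)

/-- A leaf `X t` has label-degree `0` (in every degree slot `D` only `0`/`1` coefficients occur: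
stated for `D = 0`). [folklore] -/
theorem labHom_X (t : σ) :
    ∀ e, (coeff e (X t : MvPolynomial σ (MvPolynomial τ R))).IsHomogeneous 0 := by
  classical
  intro e
  rw [coeff_X]
  split_ifs
  · exact isHomogeneous_one τ R
  · exact isHomogeneous_zero _ _ _

end LabHom

/-- **Raz 2010, Prop. 3.2 with homogeneity**: the node `b` of level `d` has coefficients
homogeneous of label-degree `2d - 2`. [cite: Raz2010, Prop. 3.2 (p. 158)] -/
theorem labHom_base [Fintype σ] : ∀ (k : ℕ) (d : Fin (r + 1)), (d : ℕ) = k →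
    ∀ (b : BIdx σ r W) (e : σ →₀ ℕ),
    (coeff e (base (R := R) d b)).IsHomogeneous (2 * k - 2) := by
  intro k
  induction k using Nat.strong_induction_on with
  | _ k ih =>
    rintro d rfl b
    rcases b with t | ⟨j, c⟩
    · rw [base]
      split_ifs with h1
      · rw [h1]; exact labHom_X t
      · intro e; rw [coeff_zero]; exact isHomogeneous_zero _ _ _
    · rw [base]
      split_ifs with h
      · have h1 : ∀ e, (coeff e (∑ b : BIdx σ r W,
            C (X (Sum.inl (d, j, c, false, b))) * base (R := R) (Fin.castSucc j) b)).IsHomogeneous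
            (1 + (2 * (j : ℕ) - 2)) :=
          labHom_sum _ fun b _ => labHom_CX_mul (ih (j : ℕ) h.2 (Fin.castSucc j) rfl b) _
        have h2 : ∀ e, (coeff e (∑ b : BIdx σ r W,
            C (X (Sum.inl (d, j, c, true, b))) *
              base (R := R) ⟨(d : ℕ) - j, by have := d.isLt; omega⟩ b)).IsHomogeneous
            (1 + (2 * ((d : ℕ) - j) - 2)) :=
          labHom_sum _ fun b _ => labHom_CX_mul (ih ((d : ℕ) - j) (by omega)
            ⟨(d : ℕ) - j, by have := d.isLt; omega⟩ rfl b) _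
        have hdeg : (1 + (2 * (j : ℕ) - 2)) + (1 + (2 * ((d : ℕ) - j) - 2)) = 2 * (d : ℕ) - 2 := by
          omega
        rw [← hdeg]
        exact labHom_mul h1 h2
      · intro e; rw [coeff_zero]; exact isHomogeneous_zero _ _ _

/-- **Every coordinate `Γ_e` of Raz's map is homogeneous of degree `2r - 1` in the labels**
(`r ≥ 1`). [cite: Raz2010, Prop. 3.2 (p. 157)] -/
theorem isHomogeneous_uCoeff [Fintype σ] (hr : 1 ≤ r) (e : σ →₀ ℕ) :
    (uCoeff R σ r W e).IsHomogeneous (2 * r - 1) := by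
  unfold uCoeff out
  have h : ∀ e, (coeff e (∑ b : BIdx σ r W,
      C (X (Sum.inr b)) * base (R := R) (Fin.last r) b)).IsHomogeneous (1 + (2 * r - 2)) :=
    labHom_sum _ fun b _ => labHom_CX_mul (labHom_base r (Fin.last r) rfl b) _
  have hdeg : 1 + (2 * r - 2) = 2 * r - 1 := by omega
  rw [← hdeg]
  exact h e

/-! ### The grading of Raz's matrix -/

/-- `∏_e Γ_e^{m_e}` is homogeneous of label-degree `(2r - 1) · |m|` (`r ≥ 1`; any finitely supported
`m` on exponent vectors). [cite: Raz2010, Prop. 3.2 (p. 157)] -/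
theorem isHomogeneous_prod_uCoeff [Fintype σ] {ι : Type*} (hr : 1 ≤ r) (v : ι → (σ →₀ ℕ))
    (m : ι →₀ ℕ) :
    (m.prod fun i k => uCoeff R σ r W (v i) ^ k).IsHomogeneous ((2 * r - 1) * m.degree) := by
  classical
  have h := IsHomogeneous.prod m.support (fun i => uCoeff R σ r W (v i) ^ m i)
    (fun i => (2 * r - 1) * m i) fun i _ => (isHomogeneous_uCoeff hr (v i)).pow (m i)
  have hsum : ∑ i ∈ m.support, (2 * r - 1) * m i = (2 * r - 1) * m.degree := by
    rw [← Finset.mul_sum]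
    rfl
  rw [← hsum]
  exact h

/-- **Block structure of Raz's matrix**: the entry `N(m, κ) = coeff_κ ∏_e Γ_e^{m_e}` vanishes unless
`|κ| = (2r - 1) · |m|` (over any coefficient semiring, in particular over `ℕ`).
[cite: Raz2010, Prop. 3.2 (p. 157)] -/
theorem coeff_prod_uCoeff_eq_zero [Fintype σ] {ι : Type*} (hr : 1 ≤ r) (v : ι → (σ →₀ ℕ))
    (m : ι →₀ ℕ)
    {κ : Lab σ r W →₀ ℕ} (hκ : κ.degree ≠ (2 * r - 1) * m.degree) :
    coeff κ (m.prod fun i k => uCoeff R σ r W (v i) ^ k) = 0 :=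
  (isHomogeneous_prod_uCoeff hr v m).coeff_eq_zero hκ

/-- The block structure in the format of `definableEquations_iff_combinatorial` (`n ≥ 1`): the
`κ`-row of the `ℕ`-system only involves the monomials `m` of `E` with `(2n - 1) · |m| = |κ|`.
[cite: Raz2010, Prop. 3.2 (p. 157)] -/
theorem row_eq_sum_filter {n b : ℕ} (hn : 1 ≤ n) (E : MvPolynomial ↥(topMonomials n) ℂ)
    (κ : Lab (Fin n) n (razSlots n b) →₀ ℕ) :
    ∑ m ∈ E.support, coeff m E *
        ((coeff κ (m.prod fun e k =>
          uCoeff ℕ (Fin n) n (razSlots n b) (e : Fin n →₀ ℕ) ^ k) : ℕ) : ℂ) =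
      ∑ m ∈ E.support.filter (fun m => (2 * n - 1) * m.degree = κ.degree), coeff m E *
        ((coeff κ (m.prod fun e k =>
          uCoeff ℕ (Fin n) n (razSlots n b) (e : Fin n →₀ ℕ) ^ k) : ℕ) : ℂ) := by
  classical
  rw [Finset.sum_filter]
  refine Finset.sum_congr rfl fun m _ => ?_
  split_ifs with h
  · rfl
  · rw [coeff_prod_uCoeff_eq_zero hn (fun e : ↥(topMonomials n) => (e : Fin n →₀ ℕ)) m
      (fun h' => h h'.symm), Nat.cast_zero, mul_zero]

end RazHomogeneity

end Summit.ValiantsHypothesis.ValiantsHypothesis.Theorems.BarrierLeverDefinableEquations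

end
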